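import Summits.AnomalousDissipation.AnomalousDissipation.Theorems.SawtoothPulseCascadeK1LocalisedCascadeLedgerThinSplit

/-!
# K1loc, line `Spectral` / thin start — helper: THE S-D TARGET IS A LOW-BAND + HIGH-OFF-CONE BOUND ON THE INVISCID ITERATES

Helper file of the prover lane on the crux `K1LocalisedCascade` (stmt-AnomalousDissipation-19491), route
`SawtoothPulseCascade` (S-B/S-C assembly seat; S-B ↔ S-D interface).  With the four-channel split and the far channels of
`…LedgerThinSplit`, the hypothesis `hiter` of `…LedgerThinClose.k1Localised_of_thin_iterate_bound` reduces — with no constant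
lost — to the two channels the start symbol actually tracks at weight one: **`K1Localised P (γ²−3)` (shape P:
`N₀ = 1`, `ρN = 2`, `d = 2`, `5 ≤ γ ≤ 8`, `0 < δ₀ ≤ ¼`; `L_min ≥ 1000`) follows from ANY `c > 0`, ONE `Q < ‖datum‖² = ½`,
and, for all large `n` or only for infinitely many `n`, `LowBand_n + HighOffCone_n ≤ Q`**
(`k1Localised_of_thin_lowBand_offCone(_frequently)`), where for the explicit inviscid iterate `a_n` of the datum
`LowBand_n = Σ'[|k₀| < (1+1/250)c(γ²−3)^n]‖𝓕a_n‖²`, `HighOffCone_n = Σ'[(1+1/250)c(γ²−3)^n ≤ |k₀| ∧ 13/10·|k₀| < γ|k₁|]‖𝓕a_n‖²`;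
and the same with the plain strip `[|k₀| ≤ (1+1/250)c(γ²−3)^n]` and the plain steep cone `[13/10·|k₀| ≤ γ|k₁|]`
(`k1Localised_of_thin_strip_cone(_frequently)`) — the indicator shapes of `…StripAverage` / `…RestColumns` / `…LineAverage`,
and — since `(1+1/250)^{2s}·Φ_n ≥ LowBand_n` for the saturated horizontal progress functional `Φ_n = Σ' min(1,(c(γ²−3)^n/|k₀|)^{2s})‖𝓕a_n‖²`
of the crux idea `renormalised-escape-weight` (`lowBand_indicator_le_saturatedWeight`) — the same from `(1+1/250)^{2s}Φ_n + HighOffCone_n ≤ Q`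
(`k1Localised_of_thin_progress_offCone_frequently`, its `K1LocalisedOfChannelBound` with the envelope channel discharged), and from a
HORIZONTAL MIX FLOOR `Φ_n(c) ≤ M c^{2s}‖datum‖²` (all `c ∈ (0,1]`, all `n`) plus a TRANSIENT high off-cone channel `≤ Cθⁿ`
(`k1Localised_of_mixFloor_offConeTransient` = its `ChannelBoundOfFloors`, def-free): that line then has exactly two stubs.
No definitions; nothing about the crux at `δ₀ = ¼`.
[cite: DEIJ2022, (1.2)–(1.3)] [cite: ElgindiLissMattingly2025, §1.2.2 and §3.1] [cite: Grafakos2014, Prop. 3.2.7 (3)] [problem: turb]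
-/

-- `Summit.<Summit>.<Problem>`: single-conjunct summit, the duplicate namespace segment is deliberate.
set_option linter.dupNamespace false

noncomputable section

namespace Summit.AnomalousDissipation.AnomalousDissipation.Theorems.SawtoothPulseCascade.K1Ledger.From

open MeasureTheory Set Filter Topology UnitAddTorus Function
open scoped ENNReal
open Literature.Analysis Literature.Analysis.FunctionSpaces Literature.Analysis.FunctionSpaces.Torus Literature.Analysis.FluidPDE
open Literature.Analysis.FluidPDE.ShearStage
open Literature.Analysis.FluidPDE.SawtoothCascade Literature.Analysis.FluidPDE.SawtoothCascade.CascadeParams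
open Summit.AnomalousDissipation.AnomalousDissipation.Theorems.SawtoothPulseCascade.K1Symbol
open Summit.AnomalousDissipation.AnomalousDissipation.Theorems.SawtoothPulseCascade.K1Start
open Summit.AnomalousDissipation.AnomalousDissipation.Theorems.SawtoothPulseCascade.K1Ledger

section Cascade

variable (P : CascadeParams)

/-! ## §1 `K1Localised` from the LOW BAND and the HIGH OFF-CONE channel of the inviscid iterates -/

/-- **`K1Localised P (γ² − 3)` from the low band and the high off-cone channel of the inviscid iterates, frequently in `n`**
(the S-D target with the far channels discharged and no constant lost).  Shape P (`N₀ = 1`, `ρN = 2`, `d = 2`,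
`5 ≤ γ ≤ 8`, `0 < δ₀ ≤ 1/4`), `L_min ≥ 1000`, ANY `c > 0`, ONE `Q < ‖datum‖² (= ½)`: if for infinitely many `n`
`Σ'[|k₀| < (1+1/250)c(γ²−3)^n]‖𝓕a_n‖² + Σ'[(1+1/250)c(γ²−3)^n ≤ |k₀| ∧ 13/10·|k₀| < γ|k₁|]‖𝓕a_n‖² ≤ Q`
for the explicit inviscid iterate `a_n` of the datum, then `K1Localised P (γ² − 3)`.
[cite: DEIJ2022, (1.2)–(1.3)] [cite: ElgindiLissMattingly2025, §1.2.2 and §3.1] [cite: Grafakos2014, Prop. 3.2.7 (3)] -/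
theorem k1Localised_of_thin_lowBand_offCone_frequently (hγ : 5 ≤ P.γ) (hγ' : P.γ ≤ 8) (hδ₀ : 0 < P.δ₀)
    (hδ₀' : P.δ₀ ≤ 1 / 4) (hd : P.d = 2) (hN₀ : P.N₀ = 1) (hρN : P.ρN = 2) {Lm : ℝ} (hLm : 1000 ≤ Lm)
    (a b : ℕ → UnitAddTorus (Fin 2) → ℝ) (has : ∀ j, IsSmooth (a j)) (h0 : a 0 = datum)
    (hb : ∀ j, b j = a j ∘ shearMap 0 1 (amp ⟨P.U j, P.U_periodic j, P.contDiff_U (P.δ_pos hδ₀ (by rw [hd]; norm_num) j)⟩ P.γ))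
    (hab : ∀ j, a (j + 1) = b j ∘ shearMap 1 0 (amp ⟨P.U j, P.U_periodic j, P.contDiff_U (P.δ_pos hδ₀ (by rw [hd]; norm_num) j)⟩ P.γ))
    {c : ℝ} (hc : 0 < c) {Q : ℝ} (hQ : Q < Torus.scalarL2Sq datum)
    (hch : ∃ᶠ n : ℕ in atTop,
      ∑' k : Fin 2 → ℤ, (if |((k 0 : ℤ) : ℝ)| < (1 + 1 / 250) * (c * (P.γ ^ 2 - 3) ^ n) then (1 : ℝ) else 0) *
          ‖mFourierCoeff (fun x => (a n x : ℂ)) k‖ ^ 2 +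
        ∑' k : Fin 2 → ℤ, (if (1 + 1 / 250) * (c * (P.γ ^ 2 - 3) ^ n) ≤ |((k 0 : ℤ) : ℝ)| ∧
            13 / 10 * |((k 0 : ℤ) : ℝ)| < P.γ * |((k 1 : ℤ) : ℝ)| then (1 : ℝ) else 0) *
          ‖mFourierCoeff (fun x => (a n x : ℂ)) k‖ ^ 2 ≤ Q) :
    K1Localised P (P.γ ^ 2 - 3) := by
  have hγ0 : 0 ≤ P.γ := by linarith
  have hd0 : 0 < P.d := by rw [hd]; norm_num
  have hr0 : 0 < P.γ ^ 2 - 3 := by nlinarith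
  have hρ0 : 0 < (P.γ ^ 2 - 5 / 2) / (1 + 1 / 250) ^ 2 - 1 / (2 * (1 + 1 / 250) * Lm) := rho_pos hγ hγ' hLm
  -- non-negativity of the channel sums, hence `0 ≤ Q` and `0 < ‖datum‖²`
  have hnn : ∀ (n : ℕ) (p : (Fin 2 → ℤ) → Prop) [DecidablePred p],
      0 ≤ ∑' k : Fin 2 → ℤ, (if p k then (1 : ℝ) else 0) * ‖mFourierCoeff (fun x => (a n x : ℂ)) k‖ ^ 2 :=
    fun n p _ => tsum_nonneg fun k => mul_nonneg (by split_ifs <;> norm_num) (sq_nonneg _)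
  obtain ⟨n₀, hn₀⟩ := hch.exists
  have hQ0 : 0 ≤ Q := le_trans (add_nonneg (hnn n₀ _) (hnn n₀ _)) hn₀
  have hE : 0 < Torus.scalarL2Sq datum := lt_of_le_of_lt hQ0 hQ
  -- the room: each far channel eventually `≤ f = (‖datum‖² − Q)/4`, level `q' = √((Q + ‖datum‖²)/2) < ‖datum‖`
  have hf : 0 < (Torus.scalarL2Sq datum - Q) / 4 := by linarith
  have hq'E : Real.sqrt ((Q + Torus.scalarL2Sq datum) / 2) < Real.sqrt (Torus.scalarL2Sq datum) :=
    Real.sqrt_lt_sqrt (by linarith) (by linarith)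
  have efar := eventually_far_iterate_le P hγ hγ' hδ₀ hd0 hLm a b has h0 hb hab hc hf
  refine k1Localised_of_thin_iterate_bound_frequently P hγ hγ' hδ₀ hδ₀' hd hN₀ hρN hLm hE a b has h0 hb hab hc
    (Real.sqrt_nonneg _) hq'E ((efar.and_frequently hch).mono fun n hn => ?_)
  obtain ⟨hfar, hlow⟩ := hn
  have hL : 0 < c * (P.γ ^ 2 - 3) ^ n := by positivity
  have hw : 0 < c * (P.γ ^ 2 - 3) ^ n / (20 * P.γ * (1 + 1 / 250)) := by positivity
  refine Real.sqrt_le_sqrt ((tsum_symProdS_sq_le_four_channels P.γ hL hw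
    (R := 2 * (c * (P.γ ^ 2 - 3) ^ n / ((P.γ ^ 2 - 5 / 2) / (1 + 1 / 250) ^ 2 - 1 / (2 * (1 + 1 / 250) * Lm)) ^ n) *
      ((1 + P.γ) ^ 2 + 1) ^ n)
    (SpectralLeakage.hasSum_sq_norm_mFourierCoeff_scalarL2Sq (has n).continuous).summable (fun k => sq_nonneg _)).trans ?_)
  have h0' := hfar 0
  have h1' := hfar 1
  linarith

/-- **`K1Localised P (γ² − 3)` from the low band and the high off-cone channel of the inviscid iterates, for all large `n`**
(same, with the bound for every `n ≥ i₁`). [cite: DEIJ2022, (1.2)–(1.3)] [cite: ElgindiLissMattingly2025, §1.2.2 and §3.1] -/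
theorem k1Localised_of_thin_lowBand_offCone (hγ : 5 ≤ P.γ) (hγ' : P.γ ≤ 8) (hδ₀ : 0 < P.δ₀)
    (hδ₀' : P.δ₀ ≤ 1 / 4) (hd : P.d = 2) (hN₀ : P.N₀ = 1) (hρN : P.ρN = 2) {Lm : ℝ} (hLm : 1000 ≤ Lm)
    (a b : ℕ → UnitAddTorus (Fin 2) → ℝ) (has : ∀ j, IsSmooth (a j)) (h0 : a 0 = datum)
    (hb : ∀ j, b j = a j ∘ shearMap 0 1 (amp ⟨P.U j, P.U_periodic j, P.contDiff_U (P.δ_pos hδ₀ (by rw [hd]; norm_num) j)⟩ P.γ))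
    (hab : ∀ j, a (j + 1) = b j ∘ shearMap 1 0 (amp ⟨P.U j, P.U_periodic j, P.contDiff_U (P.δ_pos hδ₀ (by rw [hd]; norm_num) j)⟩ P.γ))
    {c : ℝ} (hc : 0 < c) {Q : ℝ} (hQ : Q < Torus.scalarL2Sq datum) {i₁ : ℕ}
    (hch : ∀ n : ℕ, i₁ ≤ n →
      ∑' k : Fin 2 → ℤ, (if |((k 0 : ℤ) : ℝ)| < (1 + 1 / 250) * (c * (P.γ ^ 2 - 3) ^ n) then (1 : ℝ) else 0) *
          ‖mFourierCoeff (fun x => (a n x : ℂ)) k‖ ^ 2 +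
        ∑' k : Fin 2 → ℤ, (if (1 + 1 / 250) * (c * (P.γ ^ 2 - 3) ^ n) ≤ |((k 0 : ℤ) : ℝ)| ∧
            13 / 10 * |((k 0 : ℤ) : ℝ)| < P.γ * |((k 1 : ℤ) : ℝ)| then (1 : ℝ) else 0) *
          ‖mFourierCoeff (fun x => (a n x : ℂ)) k‖ ^ 2 ≤ Q) :
    K1Localised P (P.γ ^ 2 - 3) :=
  k1Localised_of_thin_lowBand_offCone_frequently P hγ hγ' hδ₀ hδ₀' hd hN₀ hρN hLm a b has h0 hb hab hc hQ
    ((eventually_atTop.2 ⟨i₁, hch⟩).frequently)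

/-! ## §2 The same with the plain STRIP and the plain STEEP CONE (the shapes of `…StripAverage` / `…LineAverage`) -/

/-- Indicator monotonicity: `[|k₀| < L'] + [L' ≤ |k₀| ∧ 13/10·|k₀| < γ|k₁|] ≤ [|k₀| ≤ L'] + [13/10·|k₀| ≤ γ|k₁|]`. [folklore] -/
theorem lowBand_add_offCone_indicator_le (γ L' : ℝ) (kh kv : ℤ) :
    (if |(kh : ℝ)| < L' then (1 : ℝ) else 0) +
        (if L' ≤ |(kh : ℝ)| ∧ 13 / 10 * |(kh : ℝ)| < γ * |(kv : ℝ)| then (1 : ℝ) else 0) ≤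
      (if |(kh : ℝ)| ≤ L' then (1 : ℝ) else 0) + (if 13 / 10 * |(kh : ℝ)| ≤ γ * |(kv : ℝ)| then (1 : ℝ) else 0) := by
  have hI : ∀ (p : Prop) [Decidable p], (0 : ℝ) ≤ (if p then (1 : ℝ) else 0) := fun p _ => by split_ifs <;> norm_num
  by_cases hA : |(kh : ℝ)| < L'
  · rw [if_pos hA, if_pos hA.le, if_neg (fun h => (not_le.2 hA) h.1), add_zero]
    linarith [hI (13 / 10 * |(kh : ℝ)| ≤ γ * |(kv : ℝ)|)]
  · rw [if_neg hA, zero_add]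
    by_cases hB : 13 / 10 * |(kh : ℝ)| < γ * |(kv : ℝ)|
    · rw [if_pos ⟨le_of_not_gt hA, hB⟩, if_pos hB.le]
      linarith [hI (|(kh : ℝ)| ≤ L')]
    · rw [if_neg (fun h => hB h.2)]
      linarith [hI (|(kh : ℝ)| ≤ L'), hI (13 / 10 * |(kh : ℝ)| ≤ γ * |(kv : ℝ)|)]

/-- **`K1Localised P (γ² − 3)` from the STRIP and the STEEP-CONE energies of the inviscid iterates** (the indicator shapes
produced by `…StripAverage.tsum_strip_real_le_windowAvg` with `L' = (1+1/250)c(γ²−3)^n` and by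
`…LineAverage.tsum_cone_le_strip_add_lineDeviation` with `a = 13/10`): ANY `c > 0`, ONE `Q < ‖datum‖²`, and for
infinitely many `n`, `Σ'[|k₀| ≤ L']‖𝓕a_n‖² + Σ'[13/10·|k₀| ≤ γ|k₁|]‖𝓕a_n‖² ≤ Q`.
[cite: DEIJ2022, (1.2)–(1.3)] [cite: ElgindiLissMattingly2025, §1.2.2 and §3.1] [cite: Grafakos2014, Prop. 3.2.7 (3)] -/
theorem k1Localised_of_thin_strip_cone_frequently (hγ : 5 ≤ P.γ) (hγ' : P.γ ≤ 8) (hδ₀ : 0 < P.δ₀)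
    (hδ₀' : P.δ₀ ≤ 1 / 4) (hd : P.d = 2) (hN₀ : P.N₀ = 1) (hρN : P.ρN = 2) {Lm : ℝ} (hLm : 1000 ≤ Lm)
    (a b : ℕ → UnitAddTorus (Fin 2) → ℝ) (has : ∀ j, IsSmooth (a j)) (h0 : a 0 = datum)
    (hb : ∀ j, b j = a j ∘ shearMap 0 1 (amp ⟨P.U j, P.U_periodic j, P.contDiff_U (P.δ_pos hδ₀ (by rw [hd]; norm_num) j)⟩ P.γ))
    (hab : ∀ j, a (j + 1) = b j ∘ shearMap 1 0 (amp ⟨P.U j, P.U_periodic j, P.contDiff_U (P.δ_pos hδ₀ (by rw [hd]; norm_num) j)⟩ P.γ))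
    {c : ℝ} (hc : 0 < c) {Q : ℝ} (hQ : Q < Torus.scalarL2Sq datum)
    (hch : ∃ᶠ n : ℕ in atTop,
      ∑' k : Fin 2 → ℤ, (if |((k 0 : ℤ) : ℝ)| ≤ (1 + 1 / 250) * (c * (P.γ ^ 2 - 3) ^ n) then (1 : ℝ) else 0) *
          ‖mFourierCoeff (fun x => (a n x : ℂ)) k‖ ^ 2 +
        ∑' k : Fin 2 → ℤ, (if 13 / 10 * |((k 0 : ℤ) : ℝ)| ≤ P.γ * |((k 1 : ℤ) : ℝ)| then (1 : ℝ) else 0) *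
          ‖mFourierCoeff (fun x => (a n x : ℂ)) k‖ ^ 2 ≤ Q) :
    K1Localised P (P.γ ^ 2 - 3) := by
  refine k1Localised_of_thin_lowBand_offCone_frequently P hγ hγ' hδ₀ hδ₀' hd hN₀ hρN hLm a b has h0 hb hab hc hQ
    (hch.mono fun n hn => le_trans ?_ hn)
  -- termwise comparison of the indicator series
  have hP := (SpectralLeakage.hasSum_sq_norm_mFourierCoeff_scalarL2Sq (has n).continuous).summable
  have hsI : ∀ (p : (Fin 2 → ℤ) → Prop) [DecidablePred p],
      Summable fun k => (if p k then (1 : ℝ) else 0) * ‖mFourierCoeff (fun x => (a n x : ℂ)) k‖ ^ 2 := by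
    intro p _
    refine Summable.of_nonneg_of_le (fun k => mul_nonneg (by split_ifs <;> norm_num) (sq_nonneg _)) (fun k => ?_) hP
    split_ifs <;> simp
  have h1 := hsI (fun k => |((k 0 : ℤ) : ℝ)| < (1 + 1 / 250) * (c * (P.γ ^ 2 - 3) ^ n))
  have h2 := hsI (fun k => (1 + 1 / 250) * (c * (P.γ ^ 2 - 3) ^ n) ≤ |((k 0 : ℤ) : ℝ)| ∧
    13 / 10 * |((k 0 : ℤ) : ℝ)| < P.γ * |((k 1 : ℤ) : ℝ)|)
  have h3 := hsI (fun k => |((k 0 : ℤ) : ℝ)| ≤ (1 + 1 / 250) * (c * (P.γ ^ 2 - 3) ^ n))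
  have h4 := hsI (fun k => 13 / 10 * |((k 0 : ℤ) : ℝ)| ≤ P.γ * |((k 1 : ℤ) : ℝ)|)
  rw [← h1.tsum_add h2, ← h3.tsum_add h4]
  refine Summable.tsum_le_tsum (fun k => ?_) (h1.add h2) (h3.add h4)
  rw [← add_mul, ← add_mul]
  exact mul_le_mul_of_nonneg_right (lowBand_add_offCone_indicator_le P.γ _ (k 0) (k 1)) (sq_nonneg _)

/-- **`K1Localised P (γ² − 3)` from the STRIP and the STEEP-CONE energies of the inviscid iterates, for all large `n`.**
[cite: DEIJ2022, (1.2)–(1.3)] [cite: ElgindiLissMattingly2025, §1.2.2 and §3.1] -/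
theorem k1Localised_of_thin_strip_cone (hγ : 5 ≤ P.γ) (hγ' : P.γ ≤ 8) (hδ₀ : 0 < P.δ₀)
    (hδ₀' : P.δ₀ ≤ 1 / 4) (hd : P.d = 2) (hN₀ : P.N₀ = 1) (hρN : P.ρN = 2) {Lm : ℝ} (hLm : 1000 ≤ Lm)
    (a b : ℕ → UnitAddTorus (Fin 2) → ℝ) (has : ∀ j, IsSmooth (a j)) (h0 : a 0 = datum)
    (hb : ∀ j, b j = a j ∘ shearMap 0 1 (amp ⟨P.U j, P.U_periodic j, P.contDiff_U (P.δ_pos hδ₀ (by rw [hd]; norm_num) j)⟩ P.γ))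
    (hab : ∀ j, a (j + 1) = b j ∘ shearMap 1 0 (amp ⟨P.U j, P.U_periodic j, P.contDiff_U (P.δ_pos hδ₀ (by rw [hd]; norm_num) j)⟩ P.γ))
    {c : ℝ} (hc : 0 < c) {Q : ℝ} (hQ : Q < Torus.scalarL2Sq datum) {i₁ : ℕ}
    (hch : ∀ n : ℕ, i₁ ≤ n →
      ∑' k : Fin 2 → ℤ, (if |((k 0 : ℤ) : ℝ)| ≤ (1 + 1 / 250) * (c * (P.γ ^ 2 - 3) ^ n) then (1 : ℝ) else 0) *
          ‖mFourierCoeff (fun x => (a n x : ℂ)) k‖ ^ 2 +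
        ∑' k : Fin 2 → ℤ, (if 13 / 10 * |((k 0 : ℤ) : ℝ)| ≤ P.γ * |((k 1 : ℤ) : ℝ)| then (1 : ℝ) else 0) *
          ‖mFourierCoeff (fun x => (a n x : ℂ)) k‖ ^ 2 ≤ Q) :
    K1Localised P (P.γ ^ 2 - 3) :=
  k1Localised_of_thin_strip_cone_frequently P hγ hγ' hδ₀ hδ₀' hd hN₀ hρN hLm a b has h0 hb hab hc hQ
    ((eventually_atTop.2 ⟨i₁, hch⟩).frequently)

/-! ## §3 The same with a SATURATED horizontal weight in place of the sharp low band (crux idea `renormalised-escape-weight`) -/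

/-- **The sharp low band is dominated by the saturated horizontal weight**: for `0 ≤ s`, `0 < L`,
`[|k₀| < (1+1/250)L] ≤ (1+1/250)^{2s}·w(k₀)` with `w(0) = 1`, `w(k₀) = min(1, (L/|k₀|)^{2s})` otherwise. [folklore] -/
theorem lowBand_indicator_le_saturatedWeight {s L : ℝ} (hs : 0 ≤ s) (hL : 0 < L) (kh : ℤ) :
    (if |(kh : ℝ)| < (1 + 1 / 250) * L then (1 : ℝ) else 0) ≤
      (1 + 1 / 250) ^ (2 * s) * (if kh = 0 then (1 : ℝ) else min 1 ((L / |(kh : ℝ)|) ^ (2 * s))) := by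
  have h1 : (1 : ℝ) ≤ (1 + 1 / 250) ^ (2 * s) := Real.one_le_rpow (by norm_num) (by positivity)
  by_cases hk : kh = 0
  · rw [if_pos hk]
    split_ifs
    · linarith
    · positivity
  · rw [if_neg hk]
    have hk0 : 0 < |(kh : ℝ)| := abs_pos.2 (Int.cast_ne_zero.2 hk)
    split_ifs with hlt
    · -- `|kh| < (1+1/250)L`: `(L/|kh|)^{2s} ≥ (1+1/250)^{-2s}`
      have hq : 1 / (1 + 1 / 250) ≤ L / |(kh : ℝ)| := by
        rw [div_le_div_iff₀ (by norm_num) hk0]; linarith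
      have hq' : (1 / (1 + 1 / 250) : ℝ) ^ (2 * s) ≤ (L / |(kh : ℝ)|) ^ (2 * s) :=
        Real.rpow_le_rpow (by norm_num) hq (by positivity)
      have hmin : (1 / (1 + 1 / 250) : ℝ) ^ (2 * s) ≤ min 1 ((L / |(kh : ℝ)|) ^ (2 * s)) :=
        le_min (Real.rpow_le_one (by norm_num) (by norm_num) (by positivity)) hq'
      have hprod : (1 + 1 / 250 : ℝ) ^ (2 * s) * (1 / (1 + 1 / 250) : ℝ) ^ (2 * s) = 1 := by
        rw [← Real.mul_rpow (by norm_num) (by norm_num)]; norm_num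
      calc (1 : ℝ) = (1 + 1 / 250 : ℝ) ^ (2 * s) * (1 / (1 + 1 / 250) : ℝ) ^ (2 * s) := hprod.symm
        _ ≤ (1 + 1 / 250) ^ (2 * s) * min 1 ((L / |(kh : ℝ)|) ^ (2 * s)) :=
          mul_le_mul_of_nonneg_left hmin (by positivity)
    · positivity

/-- **`K1Localised P (γ² − 3)` from the SATURATED HORIZONTAL PROGRESS FUNCTIONAL and the high off-cone channel, frequently in `n`**
(the transfer target `K1LocalisedOfChannelBound` of the crux idea `renormalised-escape-weight`, with its envelope channel already
discharged): for `0 ≤ s`, ANY `c > 0`, ONE `Q < ‖datum‖²`, and infinitely many `n`,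
`(1+1/250)^{2s}·Σ' min(1, (c(γ²−3)^n/|k₀|)^{2s})‖𝓕a_n‖² + HighOffCone_n ≤ Q` (weight `1` on the column `k₀ = 0`) implies
`K1Localised P (γ² − 3)`. [cite: DEIJ2022, (1.2)–(1.3)] [cite: ElgindiLissMattingly2025, §1.2.2 and §3.1] -/
theorem k1Localised_of_thin_progress_offCone_frequently (hγ : 5 ≤ P.γ) (hγ' : P.γ ≤ 8) (hδ₀ : 0 < P.δ₀)
    (hδ₀' : P.δ₀ ≤ 1 / 4) (hd : P.d = 2) (hN₀ : P.N₀ = 1) (hρN : P.ρN = 2) {Lm : ℝ} (hLm : 1000 ≤ Lm)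
    (a b : ℕ → UnitAddTorus (Fin 2) → ℝ) (has : ∀ j, IsSmooth (a j)) (h0 : a 0 = datum)
    (hb : ∀ j, b j = a j ∘ shearMap 0 1 (amp ⟨P.U j, P.U_periodic j, P.contDiff_U (P.δ_pos hδ₀ (by rw [hd]; norm_num) j)⟩ P.γ))
    (hab : ∀ j, a (j + 1) = b j ∘ shearMap 1 0 (amp ⟨P.U j, P.U_periodic j, P.contDiff_U (P.δ_pos hδ₀ (by rw [hd]; norm_num) j)⟩ P.γ))
    {s : ℝ} (hs : 0 ≤ s) {c : ℝ} (hc : 0 < c) {Q : ℝ} (hQ : Q < Torus.scalarL2Sq datum)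
    (hch : ∃ᶠ n : ℕ in atTop,
      (1 + 1 / 250) ^ (2 * s) * ∑' k : Fin 2 → ℤ, (if k 0 = 0 then (1 : ℝ) else
          min 1 ((c * (P.γ ^ 2 - 3) ^ n / |((k 0 : ℤ) : ℝ)|) ^ (2 * s))) * ‖mFourierCoeff (fun x => (a n x : ℂ)) k‖ ^ 2 +
        ∑' k : Fin 2 → ℤ, (if (1 + 1 / 250) * (c * (P.γ ^ 2 - 3) ^ n) ≤ |((k 0 : ℤ) : ℝ)| ∧
            13 / 10 * |((k 0 : ℤ) : ℝ)| < P.γ * |((k 1 : ℤ) : ℝ)| then (1 : ℝ) else 0) *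
          ‖mFourierCoeff (fun x => (a n x : ℂ)) k‖ ^ 2 ≤ Q) :
    K1Localised P (P.γ ^ 2 - 3) := by
  have hr0 : 0 < P.γ ^ 2 - 3 := by nlinarith
  refine k1Localised_of_thin_lowBand_offCone_frequently P hγ hγ' hδ₀ hδ₀' hd hN₀ hρN hLm a b has h0 hb hab hc hQ
    (hch.mono fun n hn => ?_)
  -- the sharp low band under the saturated weight, termwise
  suffices hlow : ∑' k : Fin 2 → ℤ, (if |((k 0 : ℤ) : ℝ)| < (1 + 1 / 250) * (c * (P.γ ^ 2 - 3) ^ n) then (1 : ℝ) else 0) *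
      ‖mFourierCoeff (fun x => (a n x : ℂ)) k‖ ^ 2 ≤
      (1 + 1 / 250) ^ (2 * s) * ∑' k : Fin 2 → ℤ, (if k 0 = 0 then (1 : ℝ) else
          min 1 ((c * (P.γ ^ 2 - 3) ^ n / |((k 0 : ℤ) : ℝ)|) ^ (2 * s))) * ‖mFourierCoeff (fun x => (a n x : ℂ)) k‖ ^ 2 by
    linarith
  have hL : 0 < c * (P.γ ^ 2 - 3) ^ n := by positivity
  have hP := (SpectralLeakage.hasSum_sq_norm_mFourierCoeff_scalarL2Sq (has n).continuous).summable
  have hw1 : ∀ k : Fin 2 → ℤ, (if k 0 = 0 then (1 : ℝ) else min 1 ((c * (P.γ ^ 2 - 3) ^ n / |((k 0 : ℤ) : ℝ)|) ^ (2 * s))) ≤ 1 := by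
    intro k; split_ifs
    · exact le_rfl
    · exact min_le_left _ _
  have hw0 : ∀ k : Fin 2 → ℤ, 0 ≤ (if k 0 = 0 then (1 : ℝ) else min 1 ((c * (P.γ ^ 2 - 3) ^ n / |((k 0 : ℤ) : ℝ)|) ^ (2 * s))) := by
    intro k; split_ifs
    · norm_num
    · exact le_min zero_le_one (by positivity)
  have hsw : Summable fun k : Fin 2 → ℤ => (if k 0 = 0 then (1 : ℝ) else
      min 1 ((c * (P.γ ^ 2 - 3) ^ n / |((k 0 : ℤ) : ℝ)|) ^ (2 * s))) * ‖mFourierCoeff (fun x => (a n x : ℂ)) k‖ ^ 2 :=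
    Summable.of_nonneg_of_le (fun k => mul_nonneg (hw0 k) (sq_nonneg _))
      (fun k => (mul_le_of_le_one_left (sq_nonneg _) (hw1 k))) hP
  have hsI : Summable fun k : Fin 2 → ℤ => (if |((k 0 : ℤ) : ℝ)| < (1 + 1 / 250) * (c * (P.γ ^ 2 - 3) ^ n) then (1 : ℝ) else 0) *
      ‖mFourierCoeff (fun x => (a n x : ℂ)) k‖ ^ 2 := by
    refine Summable.of_nonneg_of_le (fun k => mul_nonneg (by split_ifs <;> norm_num) (sq_nonneg _)) (fun k => ?_) hP
    split_ifs <;> simp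
  rw [← tsum_mul_left]
  refine Summable.tsum_le_tsum (fun k => ?_) hsI (hsw.mul_left _)
  exact (mul_le_mul_of_nonneg_right (lowBand_indicator_le_saturatedWeight hs hL (k 0)) (sq_nonneg _)).trans_eq
    (mul_assoc _ _ _)

/-- **`K1Localised P (γ² − 3)` from a HORIZONTAL MIX FLOOR and a TRANSIENT high off-cone channel** (the glue
`ChannelBoundOfFloors ∘ K1LocalisedOfChannelBound` of the crux idea `renormalised-escape-weight`, def-free; its envelope tail is
discharged in `…LedgerThinSplit`): if for some `s > 0`, `M` and ALL `c ∈ (0,1]` the saturated horizontal progress functional of the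
explicit inviscid iterates obeys `Σ' min(1,(c(γ²−3)^n/|k₀|)^{2s})‖𝓕a_n‖² ≤ M·c^{2s}·‖datum‖²` for every `n` (mix floor), and for every
`c ∈ (0,1]` the high off-cone channel is `≤ C·θⁿ` with `0 ≤ θ < 1` (transient), then `K1Localised P (γ² − 3)`: choose `c` with
`(1+1/250)^{2s}M c^{2s} ≤ 1/8`, then `n` large. [cite: DEIJ2022, (1.2)–(1.3)] [cite: ElgindiLissMattingly2025, §1.2.2 and §3.1] -/
theorem k1Localised_of_mixFloor_offConeTransient (hγ : 5 ≤ P.γ) (hγ' : P.γ ≤ 8) (hδ₀ : 0 < P.δ₀)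
    (hδ₀' : P.δ₀ ≤ 1 / 4) (hd : P.d = 2) (hN₀ : P.N₀ = 1) (hρN : P.ρN = 2) {Lm : ℝ} (hLm : 1000 ≤ Lm)
    (hE : 0 < Torus.scalarL2Sq datum)
    (a b : ℕ → UnitAddTorus (Fin 2) → ℝ) (has : ∀ j, IsSmooth (a j)) (h0 : a 0 = datum)
    (hb : ∀ j, b j = a j ∘ shearMap 0 1 (amp ⟨P.U j, P.U_periodic j, P.contDiff_U (P.δ_pos hδ₀ (by rw [hd]; norm_num) j)⟩ P.γ))
    (hab : ∀ j, a (j + 1) = b j ∘ shearMap 1 0 (amp ⟨P.U j, P.U_periodic j, P.contDiff_U (P.δ_pos hδ₀ (by rw [hd]; norm_num) j)⟩ P.γ))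
    {s : ℝ} (hs : 0 < s) {M : ℝ}
    (hfloor : ∀ c : ℝ, 0 < c → c ≤ 1 → ∀ n : ℕ,
      ∑' k : Fin 2 → ℤ, (if k 0 = 0 then (1 : ℝ) else
          min 1 ((c * (P.γ ^ 2 - 3) ^ n / |((k 0 : ℤ) : ℝ)|) ^ (2 * s))) * ‖mFourierCoeff (fun x => (a n x : ℂ)) k‖ ^ 2 ≤
        M * c ^ (2 * s) * Torus.scalarL2Sq datum)
    (htrans : ∀ c : ℝ, 0 < c → c ≤ 1 → ∃ C θ : ℝ, 0 ≤ θ ∧ θ < 1 ∧ ∀ n : ℕ,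
      ∑' k : Fin 2 → ℤ, (if (1 + 1 / 250) * (c * (P.γ ^ 2 - 3) ^ n) ≤ |((k 0 : ℤ) : ℝ)| ∧
          13 / 10 * |((k 0 : ℤ) : ℝ)| < P.γ * |((k 1 : ℤ) : ℝ)| then (1 : ℝ) else 0) *
        ‖mFourierCoeff (fun x => (a n x : ℂ)) k‖ ^ 2 ≤ C * θ ^ n) :
    K1Localised P (P.γ ^ 2 - 3) := by
  set E : ℝ := Torus.scalarL2Sq datum with hEdef
  -- the constant in front of `c^{2s}`, made positive
  set K : ℝ := (1 + 1 / 250) ^ (2 * s) * max M 0 + 1 with hK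
  have hA0 : 0 < (1 + 1 / 250 : ℝ) ^ (2 * s) := by positivity
  have hK0 : 0 < K := by positivity
  have hMK : (1 + 1 / 250) ^ (2 * s) * M ≤ K := by
    have : (1 + 1 / 250 : ℝ) ^ (2 * s) * M ≤ (1 + 1 / 250) ^ (2 * s) * max M 0 :=
      mul_le_mul_of_nonneg_left (le_max_left _ _) hA0.le
    linarith
  -- the constant `c`: `c^{2s} = t = min 1 (1/(8K))`
  set t : ℝ := min 1 (1 / (8 * K)) with ht
  have ht0 : 0 < t := lt_min one_pos (by positivity)
  have ht1 : t ≤ 1 := min_le_left _ _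
  have htK : K * t ≤ 1 / 8 := by
    calc K * t ≤ K * (1 / (8 * K)) := mul_le_mul_of_nonneg_left (min_le_right _ _) hK0.le
      _ = 1 / 8 := by field_simp
  have h2s : 2 * s ≠ 0 := by positivity
  set c : ℝ := t ^ (2 * s)⁻¹ with hc
  have hc0 : 0 < c := Real.rpow_pos_of_pos ht0 _
  have hc1 : c ≤ 1 := Real.rpow_le_one ht0.le ht1 (by positivity)
  have hct : c ^ (2 * s) = t := Real.rpow_inv_rpow ht0.le h2s
  -- the transient channel at this `c`
  obtain ⟨C, θ, hθ0, hθ1, hoff⟩ := htrans c hc0 hc1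
  have eoff : ∀ᶠ n : ℕ in atTop, C * θ ^ n ≤ E / 8 := by
    have hT : Tendsto (fun n : ℕ => C * θ ^ n) atTop (𝓝 (C * 0)) :=
      (tendsto_pow_atTop_nhds_zero_of_lt_one hθ0 hθ1).const_mul C
    rw [mul_zero] at hT
    exact hT.eventually (ge_mem_nhds (by positivity))
  refine k1Localised_of_thin_progress_offCone_frequently P hγ hγ' hδ₀ hδ₀' hd hN₀ hρN hLm a b has h0 hb hab hs.le hc0
    (Q := E / 4) (by rw [hEdef]; linarith) (Filter.Eventually.frequently (eoff.mono fun n hn => ?_))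
  have hΦ := hfloor c hc0 hc1 n
  have hΦ' : (1 + 1 / 250) ^ (2 * s) * ∑' k : Fin 2 → ℤ, (if k 0 = 0 then (1 : ℝ) else
      min 1 ((c * (P.γ ^ 2 - 3) ^ n / |((k 0 : ℤ) : ℝ)|) ^ (2 * s))) * ‖mFourierCoeff (fun x => (a n x : ℂ)) k‖ ^ 2 ≤ E / 8 := by
    calc (1 + 1 / 250) ^ (2 * s) * ∑' k : Fin 2 → ℤ, (if k 0 = 0 then (1 : ℝ) else
          min 1 ((c * (P.γ ^ 2 - 3) ^ n / |((k 0 : ℤ) : ℝ)|) ^ (2 * s))) * ‖mFourierCoeff (fun x => (a n x : ℂ)) k‖ ^ 2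
        ≤ (1 + 1 / 250) ^ (2 * s) * (M * c ^ (2 * s) * E) := mul_le_mul_of_nonneg_left hΦ hA0.le
      _ = ((1 + 1 / 250) ^ (2 * s) * M) * t * E := by rw [hct]; ring
      _ ≤ K * t * E := by gcongr
      _ ≤ 1 / 8 * E := by gcongr
      _ = E / 8 := by ring
  linarith [hoff n]

end Cascade

end Summit.AnomalousDissipation.AnomalousDissipation.Theorems.SawtoothPulseCascade.K1Ledger.From
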